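import Literature.AlgebraicGeometry.ShimuraVarieties.UnitaryCurveConjugateSheetPointLaw   -- ★ p850504 §0 `thickeningLift_left_comp_eq_specAut_comp` (`ℓ_{e∘γ} Q = Spec σ ≫ ℓ_e (σ⁻¹ • Q)`)
import Literature.AlgebraicGeometry.Motives.GaloisThickeningLiftTwist                     -- ★ p850817 `thickeningLift_comp_algEquiv_left` (`ℓ_{e∘γ} P = ℓ_e P ≫ gal γ⁻¹`)
import Literature.AlgebraicGeometry.AbelianSchemes.AbelianSchemeOverFibreConjugate          -- ★ `AbelianSchemeOver.specTwist` (the consumer՚s spelling of `Spec σ`)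
import HarnessLib

/-!
# The Galois twist of the base at a sheet point, read at a SPECIAL point through Shimura reciprocity:
# `ℓ_e(z₀) ≫ (1 × Spec γ) = Spec σ ≫ ℓ_e(σ⁻¹ • z₀)` and `σ⁻¹ • [τw, d·a₀]_K = [τw, a₀]_K`

Topic `AlgebraicGeometry/ShimuraVarieties`; namespace `Literature.AlgebraicGeometry.ShimuraVarieties.UnitaryCanonicalModel`.  THEOREMS ONLY
(no definition, no named fact, no instance, no notation, no `sorry`).  Cell `hodgecm-mathlib` (D-0151), FLOOR 0, P6 «MOD programme»
(crux hLiu418 = stmt-HodgeConjecture-24832, `--supports`, count-neutral), line «L4», closer `Lines/F0_P6a_StubESHEET.lean`, socket `stub_SHEET`,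
ROAD OF RECORD (γ′) (LA4-plan (g2) 2026-09-02 08:48:23Z), organ (B3) «the tuple isomorphism intertwines the actions at one special sheet
point per component» (frame v1 `OrganB3`, LA7-p01 (g4)): the binder **`hpt`** of ★ `SiegelAdelicMarking.pullback_map_comp_eq_of_lifts_of_globalIso`
(★ p850815, the (B3)-ADAPTER) — «the special sheet point `s′ = ℓ_{eE}(z₀)` lies over the `σ`-twist of the source point `s`: `s′ ≫ gγ = Spec σ ≫ s`» —
PRODUCED from the junction՚s lift `σ` of `γ` and an `F`-correspondent of `σ` (LA4-p03 (g3) (B3-SRC) tokens `σ hσF s hs w hw d hd a₀`).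

THE MATHEMATICS.  `X` an `L`-scheme, `E ⊇ L` a field with a sheet `e : E → ℂ` over `τ : L → ℂ`, `γ ∈ Aut_L(E)`, `σ ∈ Aut(ℂ∕τL)` with
`σ ∘ e = e ∘ γ`.  The sheet section `ℓ_e(Q) = (Q, Spec e) : Spec ℂ → X ⊗_L E` and the twist of the base `gal γ⁻¹ = 1 × Spec γ` satisfy
`ℓ_e(Q) ≫ gal γ⁻¹ = ℓ_{e∘γ}(Q)` (★ p850817) and `ℓ_{e∘γ}(Q) = Spec σ ≫ ℓ_e(σ⁻¹ • Q)` (★ p850504 §0; the tree՚s LEFT action `σ • Q = Spec σ ≫ Q`),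
whence §1.  At a SPECIAL point `z₀ = [τw, d·a₀]_K` of the canonical model `M_K` of the unitary Shimura curve, Shimura reciprocity (F3)
`σ • [τw, a₀]_K = [τw, d·a₀]_K` for an `L`-correspondent `s` of `σ` with twist `d = r_x(s)` ([Milne2005ShimuraVarieties] Def. 12.8 (59)–(62);
[Deligne1979ShimuraVarieties] 2.2.4–2.2.5; the record field `RecordSystemGS.recip`) identifies `σ⁻¹ • z₀ = [τw, a₀]_K`, whence §2 — the
point equality with BOTH points explicit special sheet points, exactly as the (B3)-adapter consumes it (`gS := gal γ⁻¹`, `s′ := ℓ_e(z₀)`,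
`s := ℓ_e([τw, a₀]_K)`, `Spec σ` spelled `AbelianSchemeOver.specTwist σ.toRingEquiv`).

* §1 `thickeningLift_left_comp_gal_eq_specAut_comp_smul` — GENERIC: `(ℓ_e Q).left ≫ gal E X γ⁻¹ = Spec σ ≫ (ℓ_e (σ⁻¹ • Q)).left`.
* §2 `RecordSystemGS.thickeningLift_left_comp_gal_eq_specTwist_comp_of_recip` — AT A SPECIAL POINT, `σ : ℂ ≃ₐ[ℚ] ℂ` fixing `τL`:
  `(ℓ_e [τw, d·a₀]_K).left ≫ gal E (M_K) γ⁻¹ = specTwist σ ≫ (ℓ_e [τw, a₀]_K).left`; `…_of_recip'` the `(a, d⁻¹·a)` spelling.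

HC_CM is proved only modulo the 7 printed citations (2 remaining: hLiu418 = stmt-HodgeConjecture-24832, h413 = stmt-HodgeConjecture-24833) until
rung 0 closes; this file is generic and count-neutral.

## References
* [Milne2005ShimuraVarieties] J. S. Milne, *Introduction to Shimura varieties* (2005; rev. 2017), Def. 12.8 (59)–(62) p. 114, §13 Prop. 13.1 p. 117, §14 pp. 124–125.
* [Deligne1979ShimuraVarieties] P. Deligne, *Variétés de Shimura: interprétation modulaire…* (1979), 2.2.4–2.2.5.
* [GortzWedhorn2020] U. Görtz, T. Wedhorn, *Algebraic Geometry I*, 2nd ed. (2020), §(4.8)–(4.9) (pp. 109–111), Prop. 4.16 (p. 101).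
* [RapoportSmithlingZhang2020Diagonal] M. Rapoport, B. Smithling, W. Zhang (2020), §3.2 p. 11 (the sheets of `M ⊗_F Fᵢ` and their twists).
-/

set_option autoImplicit false

noncomputable section

-- Mathlib's `Over`∕pull-back API is stated across semireducible wrappers (`bcSpec`, `Over.left (thickening …)`), as in ★ `GaloisThickening`.
set_option backward.isDefEq.respectTransparency false

open Function MulAction NumberField IsDedekindDomain CategoryTheory CategoryTheory.Limits Matrix AlgebraicGeometry
open scoped Matrix ComplexOrder
open Literature.AlgebraicGeometry.Motives Literature.NumberTheory.Automorphic Literature.NumberTheory.Automorphic.UnitaryGroup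
open Literature.NumberTheory.Automorphic.Liu2021.AppendixC (C5.OpenCompactSubgroup C5.SmallLevel)
open Literature.AlgebraicGeometry.Motives.AbelianVariety (bcSpec specAut)
open Literature.AlgebraicGeometry.AbelianSchemes (AbelianSchemeOver)

namespace Literature.AlgebraicGeometry.ShimuraVarieties.UnitaryCanonicalModel

variable {L : Type} [Field L] [NumberField L] [IsCMField L] {Jstar : Matrix (Fin 2) (Fin 2) L} {τ : L →+* ℂ}
  {K₀ : C5.OpenCompactSubgroup ↥(finAdelic (↥(maximalRealSubfield L)) L (IsCMField.complexConj L) 2 Jstar)}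

/-! ### §1 Generic: the twist of the base at a sheet point is the `σ`-twist of the sheet point at `σ⁻¹ • Q` -/

omit [NumberField L] [IsCMField L] in
/-- **`ℓ_e(Q) ≫ (1 × Spec γ) = Spec σ ≫ ℓ_e(σ⁻¹ • Q)`.**  For an `L`-scheme `X`, a field `E ⊇ L` with a sheet `e : E →ₐ[L] ℂ`
(`ℂ` over `L` through `τ`), `γ ∈ Aut_L(E)` and `σ ∈ Aut(ℂ∕τL)` with `σ ∘ e = e ∘ γ`: the sheet section at a complex point `Q` followed
by the Galois twist `gal γ⁻¹ = 1 × Spec γ` of `X ⊗_L E` is `Spec σ` followed by the sheet section at `σ⁻¹ • Q` (underlying morphisms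
`Spec ℂ → X ⊗_L E`).  ★ p850817 `thickeningLift_comp_algEquiv_left` ⊕ ★ p850504 §0 `thickeningLift_left_comp_eq_specAut_comp`.
[cite: GortzWedhorn2020, §(4.8)–(4.9) (pp. 109–111) and Prop. 4.16 (p. 101)] [cite: Milne2005ShimuraVarieties, Prop. 13.1 p. 117] -/
theorem thickeningLift_left_comp_gal_eq_specAut_comp_smul (X : SchemeOver L) {E : Type} [Field E] [Algebra L E]
    (e : letI : Algebra L ℂ := τ.toAlgebra; E →ₐ[L] ℂ) (γ : E ≃ₐ[L] E) (σ : letI : Algebra L ℂ := τ.toAlgebra; ℂ ≃ₐ[L] ℂ)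
    (hσγ : letI : Algebra L ℂ := τ.toAlgebra; ∀ x : E, σ (e x) = e (γ x))
    (Q : letI : Algebra L ℂ := τ.toAlgebra; ComplexPoints X) :
    letI : Algebra L ℂ := τ.toAlgebra
    (thickeningLift e X Q).left ≫ GaloisDescent.gal E X γ⁻¹ = specAut ℂ σ ≫ (thickeningLift e X (σ⁻¹ • Q)).left := by
  letI : Algebra L ℂ := τ.toAlgebra
  rw [← thickeningLift_comp_algEquiv_left]
  exact thickeningLift_left_comp_eq_specAut_comp X e γ σ hσγ Q

/-! ### §2 At a special point: Shimura reciprocity makes `σ⁻¹ • z₀` explicit -/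

/-- **Reciprocity, inverted**: for `σ ∈ Aut(ℂ∕τL)` with `L`-correspondent `s` and twist `d = r_x(s)` at the CM pair of `w`,
`σ⁻¹ • [τw, d·a₀]_K = [τw, a₀]_K` (the record field (F3) `recip`: `σ • [τw, a₀]_K = [τw, d·a₀]_K`).
[cite: Milne2005ShimuraVarieties, Def. 12.8 (59)–(62) p. 114] [cite: Deligne1979ShimuraVarieties, 2.2.4–2.2.5] -/
theorem RecordSystemGS.inv_smul_ptsSymm_mk_mul (S : RecordSystemGS L Jstar τ K₀) (K : C5.SmallLevel K₀)
    (σ : letI : Algebra L ℂ := τ.toAlgebra; ℂ ≃ₐ[L] ℂ) (s : (FiniteAdeleRing (𝓞 L) L)ˣ)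
    (hs : letI : Algebra L ℂ := τ.toAlgebra; IsArtinCorrespondent L τ s σ.toRingEquiv)
    (w : Fin 2 → L) (hw : (fun i => τ (w i)) ∈ negCone (Jstar.map τ))
    (d : ↥(finAdelic (↥(maximalRealSubfield L)) L (IsCMField.complexConj L) 2 Jstar))
    (hd : IsDiagTwistGS L Jstar w (recipFactor L s) d)
    (a₀ : ↥(finAdelic (↥(maximalRealSubfield L)) L (IsCMField.complexConj L) 2 Jstar)) :
    letI : Algebra L ℂ := τ.toAlgebra
    σ⁻¹ • (S.pts K).symm (ShimuraSetGS.mk L Jstar τ K.1.1 (fun i => τ (w i)) hw (d * a₀)) =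
      (S.pts K).symm (ShimuraSetGS.mk L Jstar τ K.1.1 (fun i => τ (w i)) hw a₀) := by
  letI : Algebra L ℂ := τ.toAlgebra
  rw [← S.recip K σ s hs w hw d hd a₀, inv_smul_smul]

/-- **THE POINT EQUALITY `hpt` AT A SPECIAL SHEET POINT.**  Canonical model `S` of the unitary Shimura curve, level `K`, a field `E ⊇ L`
with a sheet `e : E →ₐ[L] ℂ` (`ℂ` over `L` through `τ`), `γ ∈ Aut_L(E)`, `σ ∈ Aut(ℂ)` fixing `τL` with `σ ∘ e = e ∘ γ`, an
`L`-correspondent `s` of `σ` with twist `d = r_x(s)` at the CM pair of `w` (Shimura reciprocity (F3)), and `a₀ ∈ U(J⋆)(𝔸_{L⁺,f})`.  Then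
for the special points `z₀ = [τw, d·a₀]_K` (target) and `z₁ = [τw, a₀]_K` (source):
**`(ℓ_e z₀).left ≫ gal E (M_K) γ⁻¹ = Spec σ ≫ (ℓ_e z₁).left`** — the binder `hpt : s′ ≫ gS = specTwist σ.toRingEquiv ≫ s` of ★
`SiegelAdelicMarking.pullback_map_comp_eq_of_lifts_of_globalIso` at `gS := gal E (M_K) γ⁻¹ = 1 × Spec γ`, `s′ := (ℓ_e z₀).left`,
`s := (ℓ_e z₁).left`.  §1 ⊕ `σ⁻¹ • z₀ = z₁` (`inv_smul_ptsSymm_mk_mul`).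
[cite: Milne2005ShimuraVarieties, Def. 12.8 (59)–(62) p. 114 and §14 pp. 124–125] [cite: Deligne1979ShimuraVarieties, 2.2.4–2.2.5]
[cite: GortzWedhorn2020, §(4.8)–(4.9) (pp. 109–111) and Prop. 4.16 (p. 101)] -/
theorem RecordSystemGS.thickeningLift_left_comp_gal_eq_specTwist_comp_of_recip (S : RecordSystemGS L Jstar τ K₀) (K : C5.SmallLevel K₀)
    {E : Type} [Field E] [Algebra L E] (e : letI : Algebra L ℂ := τ.toAlgebra; E →ₐ[L] ℂ) (γ : E ≃ₐ[L] E)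
    (σ : ℂ ≃ₐ[ℚ] ℂ) (hσL : ∀ y : L, σ (τ y) = τ y) (hσγ : ∀ x : E, σ (e x) = e (γ x))
    (s : (FiniteAdeleRing (𝓞 L) L)ˣ) (hs : IsArtinCorrespondent L τ s σ.toRingEquiv)
    (w : Fin 2 → L) (hw : (fun i => τ (w i)) ∈ negCone (Jstar.map τ))
    (d : ↥(finAdelic (↥(maximalRealSubfield L)) L (IsCMField.complexConj L) 2 Jstar))
    (hd : IsDiagTwistGS L Jstar w (recipFactor L s) d)
    (a₀ : ↥(finAdelic (↥(maximalRealSubfield L)) L (IsCMField.complexConj L) 2 Jstar)) :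
    letI : Algebra L ℂ := τ.toAlgebra
    (thickeningLift e (S.M.obj K) ((S.pts K).symm (ShimuraSetGS.mk L Jstar τ K.1.1 (fun i => τ (w i)) hw (d * a₀)))).left ≫
        GaloisDescent.gal E (S.M.obj K) γ⁻¹ =
      AbelianSchemeOver.specTwist σ.toRingEquiv ≫
        (thickeningLift e (S.M.obj K) ((S.pts K).symm (ShimuraSetGS.mk L Jstar τ K.1.1 (fun i => τ (w i)) hw a₀))).left := by
  letI : Algebra L ℂ := τ.toAlgebra
  -- `σ` as an automorphism of `ℂ` over `τL`
  let σL : ℂ ≃ₐ[L] ℂ := AlgEquiv.ofRingEquiv (f := σ.toRingEquiv) (fun y => hσL y)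
  have hσLγ : ∀ x : E, σL (e x) = e (γ x) := hσγ
  have hsL : IsArtinCorrespondent L τ s σL.toRingEquiv := hs
  have key := thickeningLift_left_comp_gal_eq_specAut_comp_smul (τ := τ) (S.M.obj K) e γ σL hσLγ
    ((S.pts K).symm (ShimuraSetGS.mk L Jstar τ K.1.1 (fun i => τ (w i)) hw (d * a₀)))
  -- `Spec σL = Spec σ` (same underlying ring automorphism) and `σL⁻¹ • z₀ = [τw, a₀]_K` by reciprocity
  have hS : specAut ℂ σL = AbelianSchemeOver.specTwist σ.toRingEquiv := rfl
  rw [S.inv_smul_ptsSymm_mk_mul K σL s hsL w hw d hd a₀, hS] at key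
  exact key

/-- **`hpt`, the `(a, d⁻¹·a)` spelling**: for the special sheet point over `z₀ = [τw, a]_K` the source point is `[τw, d⁻¹·a]_K`:
`(ℓ_e [τw, a]_K).left ≫ gal E (M_K) γ⁻¹ = Spec σ ≫ (ℓ_e [τw, d⁻¹·a]_K).left`.
[cite: Milne2005ShimuraVarieties, Def. 12.8 (59)–(62) p. 114 and §14 pp. 124–125] [cite: Deligne1979ShimuraVarieties, 2.2.4–2.2.5] -/
theorem RecordSystemGS.thickeningLift_left_comp_gal_eq_specTwist_comp_of_recip' (S : RecordSystemGS L Jstar τ K₀) (K : C5.SmallLevel K₀)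
    {E : Type} [Field E] [Algebra L E] (e : letI : Algebra L ℂ := τ.toAlgebra; E →ₐ[L] ℂ) (γ : E ≃ₐ[L] E)
    (σ : ℂ ≃ₐ[ℚ] ℂ) (hσL : ∀ y : L, σ (τ y) = τ y) (hσγ : ∀ x : E, σ (e x) = e (γ x))
    (s : (FiniteAdeleRing (𝓞 L) L)ˣ) (hs : IsArtinCorrespondent L τ s σ.toRingEquiv)
    (w : Fin 2 → L) (hw : (fun i => τ (w i)) ∈ negCone (Jstar.map τ))
    (d : ↥(finAdelic (↥(maximalRealSubfield L)) L (IsCMField.complexConj L) 2 Jstar))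
    (hd : IsDiagTwistGS L Jstar w (recipFactor L s) d)
    (a : ↥(finAdelic (↥(maximalRealSubfield L)) L (IsCMField.complexConj L) 2 Jstar)) :
    letI : Algebra L ℂ := τ.toAlgebra
    (thickeningLift e (S.M.obj K) ((S.pts K).symm (ShimuraSetGS.mk L Jstar τ K.1.1 (fun i => τ (w i)) hw a))).left ≫
        GaloisDescent.gal E (S.M.obj K) γ⁻¹ =
      AbelianSchemeOver.specTwist σ.toRingEquiv ≫
        (thickeningLift e (S.M.obj K) ((S.pts K).symm (ShimuraSetGS.mk L Jstar τ K.1.1 (fun i => τ (w i)) hw (d⁻¹ * a)))).left := by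
  have key := S.thickeningLift_left_comp_gal_eq_specTwist_comp_of_recip K e γ σ hσL hσγ s hs w hw d hd (d⁻¹ * a)
  rwa [mul_inv_cancel_left] at key

end Literature.AlgebraicGeometry.ShimuraVarieties.UnitaryCanonicalModel

end
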